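import Literature.NumberTheory.IwasawaTheory.FukudaSmallRankAlgebra
import HarnessLib

/-!
# The coinvariant small-rank lemma: `[M : (φ^{p^i} - 1)M + pM] < p^{p^i}` forces `(φ^{p^i} - 1)M ⊆ pM`
# (the module algebra of the ONE-PAIR-OF-LAYERS COINVARIANT criterion for `μ = 0`, door L12 of the cell `bsd-potss`; proved)

`Proofs`-style file (theorems only: no definition, no named fact, no `sorry`) in topic `NumberTheory/IwasawaTheory`
(namespace `Literature.NumberTheory.IwasawaTheory.FukudaCoinvariant`), written by the prover seat `bsd-potss-k9-c4` g26
(cell `bsd-potss`; `μ`-roads of the record lane of stmt-BirchSwinnertonDyer-19197; closes nothing).  Companion of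
`FukudaSmallRankAlgebra` (conjA-anchor g20: `[M : ν_j Y + pM] < p^{p^j - 1} ⟹ ν_j Y ⊆ pM`).

THE LEMMA (`map_pow_sub_one_le_of_card_quotient_lt`).  `M` a finite abelian group, `φ ∈ End(M)` with `φ^{p^t} = 1`, `pM` the multiples of
`p`, `ω_i = φ^{p^i} - 1`.  If `#(M/(ω_i M + pM)) < p^{p^i}` then `ω_i M ⊆ pM`.  Proof: on `M̄ = M/pM` (an `𝔽_p`-vector space) `T = φ̄ - 1` is
nilpotent and `ω̄_i = φ̄^{p^i} - 1 = T^{p^i}` (Frobenius); for a nilpotent `T` with `T^c ≠ 0` the chain `M̄ ⊋ TM̄ ⊋ ⋯ ⊋ T^cM̄` is strict, so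
`dim M̄/T^cM̄ ≥ c` (`FukudaSmallRank.finrank_range_pow_add_le`); with `c = p^i` this contradicts the hypothesis unless `T^{p^i} = 0`.

CONSEQUENCES.  `map_geom_sum_le_sup` (`i < j`): `ν_j Y ⊆ ω_i M + pM` (`ν̄_j = T^{p^j-1}` and `p^j - 1 ≥ p^i`);
`card_quotient_le_of_card_quotient_coinvariant_lt` (`i < j`): if `#(M/(ν_j Y + pM + ω_i M)) < p^{p^i}` then
`#(M/(ν_k Y + pM)) ≤ #(M/(ν_j Y + pM + ω_i M))` for EVERY `k` and every `Y` (indeed `#(M/pM)` equals the right side).  This is the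
module-theoretic shadow of «if `μ(X) > 0` then `X̄ = X/pX` has a free `𝔽_p⟦T⟧`-summand and the `Gal(K_{n+i+1}/K_{n+i})`-coinvariants of
`A_{n+i+1}/p`, which are `X̄/T^{p^i}X̄` whatever `Y₀` is, have dimension `≥ p^i`» (Washington §13.3), at finite level and without the
structure theory; the quotient `M/(ν_j Y + pM + ω_i M)` is `[G_j : N_j·P_j·⁅G_i, G_j⁆]` in Fukuda's package (`FukudaGroupCoinvariantLayer`).

References: [Washington1997] L. Washington, *Introduction to Cyclotomic Fields*, 2nd ed., GTM 83, §13.3 Lemmas 13.15, 13.18,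
Prop. 13.22–13.23; [Fukuda1994] T. Fukuda, *Remarks on ℤ_p-extensions of number fields*, Proc. Japan Acad. 70 A (1994), Thm. 1
(the finite-level method); [Lang1990] S. Lang, *Cyclotomic Fields I and II*, Ch. 13 §4 (genus theory), Ch. 5 §1.
-/

set_option autoImplicit false

noncomputable section

open Finset Polynomial Module

namespace Literature.NumberTheory.IwasawaTheory.FukudaCoinvariant

/-! ## §1 Two polynomial identities in characteristic `p` -/

section CharP

variable {p : ℕ} [Fact p.Prime]

/-- `∑_{i<p^j} (1+T)^i = T^{p^j - 1}` for `T` in any `𝔽_p`-algebra. [folklore] -/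
private theorem geom_sum_one_add_eq_pow {A : Type*} [Ring A] [Algebra (ZMod p) A] (T : A) (j : ℕ) :
    (∑ i ∈ range (p ^ j), (1 + T) ^ i) = T ^ (p ^ j - 1) := by
  have hp : p.Prime := Fact.out
  have hpoly : (∑ i ∈ range (p ^ j), ((1 : (ZMod p)[X]) + X) ^ i) = X ^ (p ^ j - 1) := by
    have h := geom_sum_mul ((1 : (ZMod p)[X]) + X) (p ^ j)
    rw [add_sub_cancel_left, add_pow_char_pow, one_pow, add_sub_cancel_left] at h
    have hX : (X : (ZMod p)[X]) ≠ 0 := X_ne_zero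
    have hpj : 1 ≤ p ^ j := Nat.one_le_pow _ _ hp.pos
    refine mul_right_cancel₀ hX ?_
    rw [h, ← pow_succ, Nat.sub_add_cancel hpj]
  have h := congrArg (Polynomial.aeval T) hpoly
  rw [map_sum, map_pow, aeval_X] at h
  simp_rw [map_pow, map_add, map_one, aeval_X] at h
  exact h

/-- `(ψ - 1)^{p^t} = ψ^{p^t} - 1` for `ψ` in any `𝔽_p`-algebra. [folklore] -/
private theorem sub_one_pow_char_pow {A : Type*} [Ring A] [Algebra (ZMod p) A] (ψ : A) (t : ℕ) :
    (ψ - 1) ^ p ^ t = ψ ^ p ^ t - 1 := by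
  have hpoly : ((X : (ZMod p)[X]) - 1) ^ p ^ t = X ^ p ^ t - 1 := by
    rw [sub_pow_char_pow, one_pow]
  have h := congrArg (Polynomial.aeval ψ) hpoly
  rw [map_pow, map_sub, map_sub, map_pow, aeval_X, map_one] at h
  exact h

end CharP

/-! ## §2 Core: `dim N/(ψ^{p^i} - 1)N ≥ p^i` unless `ψ^{p^i} = 1` on the `𝔽_p`-space `N` -/

section Core

variable {p : ℕ} [Fact p.Prime] {N : Type*} [AddCommGroup N] [Module (ZMod p) N] [Finite N]

/-- **Core (an `𝔽_p`-vector space `N`, written with `ℤ`-linear maps).**  If `φ̄ ∈ End_ℤ(N)` satisfies `φ̄^{p^t} = 1` and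
`ω̄_i = φ̄^{p^i} - 1 ≠ 0`, then `#(N/ω̄_i N) ≥ p^{p^i}`: with `T = φ̄ - 1` (nilpotent, `T^{p^t} = 0`) one has `ω̄_i = T^{p^i}` (Frobenius)
and the chain lemma `FukudaSmallRank.finrank_range_pow_add_le` applies with `c = p^i`.
[cite: Washington1997, §13.3 Lemma 13.18 and Prop. 13.22] [cite: Lang1990, Ch. 13 §4] -/
theorem pow_le_card_quotient_range_pow_sub_one (φbar : N →ₗ[ℤ] N) {t : ℕ} (hφ : φbar ^ p ^ t = 1) (i : ℕ)
    (hne : (φbar ^ p ^ i - 1) ≠ 0) :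
    p ^ (p ^ i) ≤ Nat.card (N ⧸ LinearMap.range (φbar ^ p ^ i - 1)) := by
  have hp : p.Prime := Fact.out
  set c : ℕ := p ^ i with hcdef
  set ωbar : N →ₗ[ℤ] N := φbar ^ p ^ i - 1 with hωbar
  -- the same maps, `𝔽_p`-linearly
  set ψ : N →ₗ[ZMod p] N := φbar.toAddMonoidHom.toZModLinearMap p with hψdef
  have hψφ : ∀ x : N, ψ x = φbar x := fun _ => rfl
  have hψ_pow : ∀ (k : ℕ) (x : N), (ψ ^ k) x = (φbar ^ k) x := by
    intro k
    induction k with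
    | zero => intro x; rw [pow_zero, pow_zero, Module.End.one_apply, Module.End.one_apply]
    | succ k ih => intro x; rw [pow_succ, pow_succ, Module.End.mul_apply, Module.End.mul_apply, hψφ, ih]
  have hψt : ψ ^ p ^ t = 1 := by
    refine LinearMap.ext fun x => ?_
    rw [hψ_pow, hφ]
    rfl
  set T : Module.End (ZMod p) N := ψ - 1 with hTdef
  have hTnil : T ^ p ^ t = 0 := by
    rw [hTdef, sub_one_pow_char_pow (p := p) ψ t, hψt, sub_self]
  have hωT : ∀ x : N, ωbar x = (T ^ c) x := by
    intro x
    have h2 : ψ ^ p ^ i - 1 = T ^ c := by rw [hcdef, hTdef, sub_one_pow_char_pow (p := p) ψ i]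
    rw [← h2, hωbar, LinearMap.sub_apply, LinearMap.sub_apply, Module.End.one_apply, Module.End.one_apply, hψ_pow]
  have hTc : T ^ c ≠ 0 := by
    intro h0
    apply hne
    refine LinearMap.ext fun x => ?_
    rw [show (φbar ^ p ^ i - 1) x = ωbar x from rfl, hωT, h0, LinearMap.zero_apply, LinearMap.zero_apply]
  have hrank := FukudaSmallRank.finrank_range_pow_add_le T hTnil hTc
  have hquot : finrank (ZMod p) (N ⧸ LinearMap.range (T ^ c)) + finrank (ZMod p) (LinearMap.range (T ^ c)) =
      finrank (ZMod p) N := Submodule.finrank_quotient_add_finrank _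
  have hcle : c ≤ finrank (ZMod p) (N ⧸ LinearMap.range (T ^ c)) := by omega
  have hcard1 : p ^ c ≤ Nat.card (N ⧸ LinearMap.range (T ^ c)) := by
    rw [Module.natCard_eq_pow_finrank (K := ZMod p), Nat.card_zmod]
    exact Nat.pow_le_pow_right hp.pos hcle
  -- the two ranges have the same elements
  have hS := Submodule.card_eq_card_quotient_mul_card (LinearMap.range ωbar)
  have hR := Submodule.card_eq_card_quotient_mul_card (LinearMap.range (T ^ c))
  have hsub : ((LinearMap.range (T ^ c) : Submodule (ZMod p) N) : Set N) ⊆ LinearMap.range ωbar := by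
    rintro _ ⟨x, rfl⟩
    exact ⟨x, hωT x⟩
  have hRS : Nat.card (LinearMap.range (T ^ c)) ≤ Nat.card (LinearMap.range ωbar) :=
    Nat.card_le_card_of_injective (Set.inclusion hsub) (Set.inclusion_injective hsub)
  have hsub' : ((LinearMap.range ωbar : Submodule ℤ N) : Set N) ⊆ LinearMap.range (T ^ c) := by
    rintro _ ⟨x, rfl⟩
    exact ⟨x, (hωT x).symm⟩
  have hSR : Nat.card (LinearMap.range ωbar) ≤ Nat.card (LinearMap.range (T ^ c)) :=
    Nat.card_le_card_of_injective (Set.inclusion hsub') (Set.inclusion_injective hsub')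
  have heq : Nat.card (LinearMap.range ωbar) = Nat.card (LinearMap.range (T ^ c)) := le_antisymm hSR hRS
  have hpos : 0 < Nat.card (LinearMap.range ωbar) := Nat.card_pos
  have h1 : Nat.card (LinearMap.range ωbar) * Nat.card (N ⧸ LinearMap.range (T ^ c)) =
      Nat.card (LinearMap.range ωbar) * Nat.card (N ⧸ LinearMap.range ωbar) := by
    rw [← hS]
    nth_rewrite 1 [heq]
    rw [← hR]
  have h2 : Nat.card (N ⧸ LinearMap.range (T ^ c)) = Nat.card (N ⧸ LinearMap.range ωbar) :=
    Nat.eq_of_mul_eq_mul_left hpos h1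
  rw [← h2]
  exact hcard1

omit [Finite N] in
/-- **On the `𝔽_p`-space `N`: `ν̄_j N ⊆ ω̄_i N` for `i < j`** (`ν̄_j = T^{p^j-1}`, `ω̄_i = T^{p^i}`, `p^j - 1 ≥ p^i`).
[cite: Washington1997, §13.3 Lemma 13.18] -/
theorem range_geom_sum_le_range_pow_sub_one (φbar : N →ₗ[ℤ] N) {i j : ℕ} (hij : i < j) :
    LinearMap.range (∑ m ∈ range (p ^ j), φbar ^ m) ≤ LinearMap.range (φbar ^ p ^ i - 1) := by
  have hp : p.Prime := Fact.out
  set ψ : N →ₗ[ZMod p] N := φbar.toAddMonoidHom.toZModLinearMap p with hψdef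
  have hψφ : ∀ x : N, ψ x = φbar x := fun _ => rfl
  have hψ_pow : ∀ (k : ℕ) (x : N), (ψ ^ k) x = (φbar ^ k) x := by
    intro k
    induction k with
    | zero => intro x; rw [pow_zero, pow_zero, Module.End.one_apply, Module.End.one_apply]
    | succ k ih => intro x; rw [pow_succ, pow_succ, Module.End.mul_apply, Module.End.mul_apply, hψφ, ih]
  set T : Module.End (ZMod p) N := ψ - 1 with hTdef
  have hνT : ∀ x : N, (∑ m ∈ range (p ^ j), φbar ^ m) x = (T ^ (p ^ j - 1)) x := by
    intro x
    have h2 : (∑ m ∈ range (p ^ j), ψ ^ m) = T ^ (p ^ j - 1) := by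
      rw [← geom_sum_one_add_eq_pow (p := p) T j, hTdef]
      simp_rw [add_sub_cancel]
    rw [← h2, LinearMap.sum_apply, LinearMap.sum_apply]
    exact Finset.sum_congr rfl fun m _ => (hψ_pow m x).symm
  have hωT : ∀ x : N, (φbar ^ p ^ i - 1) x = (T ^ p ^ i) x := by
    intro x
    have h2 : ψ ^ p ^ i - 1 = T ^ p ^ i := by rw [hTdef, sub_one_pow_char_pow (p := p) ψ i]
    rw [← h2, LinearMap.sub_apply, LinearMap.sub_apply, Module.End.one_apply, Module.End.one_apply, hψ_pow]
  -- `p^j - 1 = p^i + d`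
  have hle : p ^ i ≤ p ^ j - 1 := by
    have h1 : p ^ i < p ^ j := Nat.pow_lt_pow_right hp.one_lt hij
    omega
  obtain ⟨d, hd⟩ : ∃ d, p ^ j - 1 = p ^ i + d := ⟨p ^ j - 1 - p ^ i, by omega⟩
  rintro _ ⟨x, rfl⟩
  refine ⟨(T ^ d) x, ?_⟩
  rw [hωT, hνT, hd, pow_add, Module.End.mul_apply]

end Core

/-! ## §3 The coinvariant small-rank lemma and its consequence for every layer -/

section Module

variable {p : ℕ} [Fact p.Prime] {M : Type*} [AddCommGroup M] [Finite M]

/-- Cardinality monotonicity of quotients: for `ℤ`-submodules `S ⊆ R` of a finite module, `#(M/R) ≤ #(M/S)`. [folklore] -/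
private theorem card_quotient_le_of_le {L : Type*} [AddCommGroup L] [Finite L] {S R : Submodule ℤ L} (h : S ≤ R) :
    Nat.card (L ⧸ R) ≤ Nat.card (L ⧸ S) := by
  have hS := Submodule.card_eq_card_quotient_mul_card S
  have hR := Submodule.card_eq_card_quotient_mul_card R
  have hSR : Nat.card S ≤ Nat.card R :=
    Nat.card_le_card_of_injective (Submodule.inclusion h) (Submodule.inclusion_injective h)
  have hSpos : 0 < Nat.card S := Nat.card_pos
  have h1 : Nat.card S * Nat.card (L ⧸ R) ≤ Nat.card S * Nat.card (L ⧸ S) := by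
    calc Nat.card S * Nat.card (L ⧸ R) ≤ Nat.card R * Nat.card (L ⧸ R) := Nat.mul_le_mul_right _ hSR
      _ = Nat.card L := hR.symm
      _ = Nat.card S * Nat.card (L ⧸ S) := hS
  exact Nat.le_of_mul_le_mul_left h1 hSpos

/-- **The coinvariant small-rank lemma.**  `M` a finite abelian group, `φ ∈ End_ℤ(M)` with `φ^{p^t} = 1`, `pM` = the image of
multiplication by `p`, `ω_i = φ^{p^i} - 1`: if `#(M/(pM + ω_i M)) < p^{p^i}` then `ω_i M ⊆ pM` (on `M̄ = M/pM`: `T = φ̄ - 1` is nilpotent,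
`ω̄_i = T^{p^i}`, and `dim M̄/T^cM̄ ≥ c` unless `T^c = 0`). [cite: Washington1997, §13.3 Lemma 13.18 and Prop. 13.22]
[cite: Lang1990, Ch. 13 §4] -/
theorem map_pow_sub_one_le_of_card_quotient_lt (φ : Module.End ℤ M) {t : ℕ} (hφ : φ ^ p ^ t = 1) (i : ℕ)
    (hlt : Nat.card (M ⧸ ((⊤ : Submodule ℤ M).map ((p : ℤ) • (1 : Module.End ℤ M)) ⊔
        (⊤ : Submodule ℤ M).map (φ ^ p ^ i - 1))) < p ^ (p ^ i)) :
    (⊤ : Submodule ℤ M).map (φ ^ p ^ i - 1) ≤ (⊤ : Submodule ℤ M).map ((p : ℤ) • (1 : Module.End ℤ M)) := by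
  have hp : p.Prime := Fact.out
  set P : Submodule ℤ M := (⊤ : Submodule ℤ M).map ((p : ℤ) • (1 : Module.End ℤ M)) with hPdef
  set ω : Module.End ℤ M := φ ^ p ^ i - 1 with hωdef
  have hmemP : ∀ m : M, (p : ℤ) • m ∈ P := fun m =>
    Submodule.mem_map.mpr ⟨m, Submodule.mem_top, by rw [LinearMap.smul_apply, Module.End.one_apply]⟩
  have hPφ : P ≤ P.comap φ := by
    intro x hx
    obtain ⟨m, -, rfl⟩ := Submodule.mem_map.mp hx
    rw [Submodule.mem_comap, LinearMap.smul_apply, Module.End.one_apply, map_zsmul]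
    exact hmemP _
  -- the `𝔽_p`-vector space `M̄ = M/pM`
  have hpQ : ∀ x : M ⧸ P, p • x = 0 := by
    intro x
    induction x using Submodule.Quotient.induction_on with
    | H m =>
      have hm : (p • m : M) ∈ P := by rw [← natCast_zsmul]; exact hmemP m
      have h := map_nsmul P.mkQ p m
      rw [Submodule.mkQ_apply, Submodule.mkQ_apply] at h
      rw [← h]
      exact (Submodule.Quotient.mk_eq_zero P).mpr hm
  haveI : Module (ZMod p) (M ⧸ P) := AddCommGroup.zmodModule hpQ
  haveI : Finite (M ⧸ P) := Finite.of_surjective _ (Submodule.Quotient.mk_surjective P)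
  -- `φ̄` on `M̄`, `φ̄^{p^t} = 1`
  set φbar : (M ⧸ P) →ₗ[ℤ] (M ⧸ P) := P.mapQ P φ hPφ with hφbar
  have hφbar_mk : ∀ m : M, φbar (Submodule.Quotient.mk m) = Submodule.Quotient.mk (φ m) := fun m =>
    Submodule.mapQ_apply P P φ m
  have hφbar_pow_mk : ∀ (k : ℕ) (m : M), (φbar ^ k) (Submodule.Quotient.mk m) = Submodule.Quotient.mk ((φ ^ k) m) := by
    intro k
    induction k with
    | zero => intro m; rw [pow_zero, pow_zero, Module.End.one_apply, Module.End.one_apply]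
    | succ k ih => intro m; rw [pow_succ, pow_succ, Module.End.mul_apply, Module.End.mul_apply, hφbar_mk, ih]
  have hφbart : φbar ^ p ^ t = 1 := by
    refine LinearMap.ext fun x => ?_
    induction x using Submodule.Quotient.induction_on with
    | H m => rw [hφbar_pow_mk, hφ, Module.End.one_apply, Module.End.one_apply]
  set ωbar : (M ⧸ P) →ₗ[ℤ] (M ⧸ P) := φbar ^ p ^ i - 1 with hωbar
  have hω_mk : ∀ m : M, Submodule.Quotient.mk (p := P) (ω m) = ωbar (Submodule.Quotient.mk m) := by
    intro m
    rw [hωdef, hωbar, LinearMap.sub_apply, LinearMap.sub_apply, Module.End.one_apply, Module.End.one_apply, hφbar_pow_mk,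
      Submodule.Quotient.mk_sub]
  -- if `ω M ⊄ pM` then `ω̄ ≠ 0`, so `#(M̄/ω̄ M̄) ≥ p^{p^i}`
  by_contra hnot
  obtain ⟨x, hx, hxP⟩ : ∃ x ∈ (⊤ : Submodule ℤ M).map ω, x ∉ P := Set.not_subset.mp hnot
  obtain ⟨y, -, rfl⟩ := Submodule.mem_map.mp hx
  have hne : ωbar ≠ 0 := by
    intro h0
    apply hxP
    rw [← Submodule.Quotient.mk_eq_zero P, hω_mk, h0, LinearMap.zero_apply]
  have hcard1 : p ^ (p ^ i) ≤ Nat.card ((M ⧸ P) ⧸ LinearMap.range ωbar) :=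
    pow_le_card_quotient_range_pow_sub_one φbar hφbart i hne
  -- `#(M/(pM + ωM)) = #(M̄ / \overline{ωM})` and `\overline{ωM} ⊆ ω̄ M̄`
  set S : Submodule ℤ M := P ⊔ (⊤ : Submodule ℤ M).map ω with hSdef
  have hPS : P ≤ S := le_sup_left
  have hcard2 : Nat.card (M ⧸ S) = Nat.card ((M ⧸ P) ⧸ S.map P.mkQ) :=
    (Nat.card_congr (Submodule.quotientQuotientEquivQuotient P S hPS).toEquiv).symm
  have hsub : S.map P.mkQ ≤ LinearMap.range ωbar := by
    rintro _ ⟨s, hs, rfl⟩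
    obtain ⟨b, hb, a, ha, rfl⟩ := Submodule.mem_sup.mp hs
    obtain ⟨y', -, rfl⟩ := Submodule.mem_map.mp ha
    rw [Submodule.mkQ_apply, Submodule.Quotient.mk_add, (Submodule.Quotient.mk_eq_zero P).mpr hb, zero_add, hω_mk]
    exact LinearMap.mem_range_self _ _
  have hcard3 : Nat.card ((M ⧸ P) ⧸ LinearMap.range ωbar) ≤ Nat.card ((M ⧸ P) ⧸ S.map P.mkQ) :=
    card_quotient_le_of_le hsub
  have : p ^ (p ^ i) ≤ Nat.card (M ⧸ S) := by rw [hcard2]; exact hcard1.trans hcard3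
  exact absurd (lt_of_le_of_lt this hlt) (lt_irrefl _)

omit [Finite M] in
/-- **`ν_j Y ⊆ pM + ω_i M` for `i < j`** (`ν_j = ∑_{m<p^j} φ^m`, `ω_i = φ^{p^i} - 1`): on `M̄ = M/pM`, `ν̄_j = T^{p^j-1} ∈ T^{p^i}·End(M̄)`
since `p^j - 1 ≥ p^i`; this is why the coinvariant quotient `M/(ν_j Y + pM + ω_i M)` does not depend on `Y`.
[cite: Washington1997, §13.3 Lemma 13.18] -/
theorem map_geom_sum_le_sup (φ : Module.End ℤ M) (Y : Submodule ℤ M) {i j : ℕ} (hij : i < j) :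
    Y.map (∑ m ∈ range (p ^ j), φ ^ m) ≤
      (⊤ : Submodule ℤ M).map ((p : ℤ) • (1 : Module.End ℤ M)) ⊔ (⊤ : Submodule ℤ M).map (φ ^ p ^ i - 1) := by
  have hp : p.Prime := Fact.out
  set P : Submodule ℤ M := (⊤ : Submodule ℤ M).map ((p : ℤ) • (1 : Module.End ℤ M)) with hPdef
  set ω : Module.End ℤ M := φ ^ p ^ i - 1 with hωdef
  set ν : Module.End ℤ M := ∑ m ∈ range (p ^ j), φ ^ m with hνdef
  have hmemP : ∀ m : M, (p : ℤ) • m ∈ P := fun m =>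
    Submodule.mem_map.mpr ⟨m, Submodule.mem_top, by rw [LinearMap.smul_apply, Module.End.one_apply]⟩
  have hPφ : P ≤ P.comap φ := by
    intro x hx
    obtain ⟨m, -, rfl⟩ := Submodule.mem_map.mp hx
    rw [Submodule.mem_comap, LinearMap.smul_apply, Module.End.one_apply, map_zsmul]
    exact hmemP _
  have hpQ : ∀ x : M ⧸ P, p • x = 0 := by
    intro x
    induction x using Submodule.Quotient.induction_on with
    | H m =>
      have hm : (p • m : M) ∈ P := by rw [← natCast_zsmul]; exact hmemP m
      have h := map_nsmul P.mkQ p m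
      rw [Submodule.mkQ_apply, Submodule.mkQ_apply] at h
      rw [← h]
      exact (Submodule.Quotient.mk_eq_zero P).mpr hm
  haveI : Module (ZMod p) (M ⧸ P) := AddCommGroup.zmodModule hpQ
  set φbar : (M ⧸ P) →ₗ[ℤ] (M ⧸ P) := P.mapQ P φ hPφ with hφbar
  have hφbar_mk : ∀ m : M, φbar (Submodule.Quotient.mk m) = Submodule.Quotient.mk (φ m) := fun m =>
    Submodule.mapQ_apply P P φ m
  have hφbar_pow_mk : ∀ (k : ℕ) (m : M), (φbar ^ k) (Submodule.Quotient.mk m) = Submodule.Quotient.mk ((φ ^ k) m) := by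
    intro k
    induction k with
    | zero => intro m; rw [pow_zero, pow_zero, Module.End.one_apply, Module.End.one_apply]
    | succ k ih => intro m; rw [pow_succ, pow_succ, Module.End.mul_apply, Module.End.mul_apply, hφbar_mk, ih]
  have hν_mk : ∀ m : M, Submodule.Quotient.mk (p := P) (ν m) = (∑ m' ∈ range (p ^ j), φbar ^ m') (Submodule.Quotient.mk m) := by
    intro m
    rw [hνdef, LinearMap.sum_apply, LinearMap.sum_apply]
    rw [show (Submodule.Quotient.mk (p := P) (∑ m' ∈ range (p ^ j), (φ ^ m') m)) =
      ∑ m' ∈ range (p ^ j), Submodule.Quotient.mk (p := P) ((φ ^ m') m) from map_sum (P.mkQ) _ _]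
    exact Finset.sum_congr rfl fun m' _ => (hφbar_pow_mk m' m).symm
  have hω_mk : ∀ m : M, Submodule.Quotient.mk (p := P) (ω m) = (φbar ^ p ^ i - 1) (Submodule.Quotient.mk m) := by
    intro m
    rw [hωdef, LinearMap.sub_apply, LinearMap.sub_apply, Module.End.one_apply, Module.End.one_apply, hφbar_pow_mk,
      Submodule.Quotient.mk_sub]
  rintro _ ⟨y, -, rfl⟩
  -- `ν̄ ȳ = ω̄ z̄` for some `z`
  obtain ⟨zbar, hz⟩ : (∑ m' ∈ range (p ^ j), φbar ^ m') (Submodule.Quotient.mk y) ∈ LinearMap.range (φbar ^ p ^ i - 1) :=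
    range_geom_sum_le_range_pow_sub_one (p := p) φbar hij (LinearMap.mem_range_self _ _)
  induction zbar using Submodule.Quotient.induction_on with
  | H z =>
    -- `ν y - ω z ∈ pM`
    have hdiff : ν y - ω z ∈ P := by
      rw [← Submodule.Quotient.mk_eq_zero P, Submodule.Quotient.mk_sub, hν_mk, hω_mk, hz, sub_self]
    have : ν y = (ν y - ω z) + ω z := by abel
    rw [this]
    exact Submodule.add_mem _ (Submodule.mem_sup_left hdiff) (Submodule.mem_sup_right ⟨z, Submodule.mem_top, rfl⟩)

/-- **Consequence for every layer: `#(M/(ν_k Y + pM)) ≤ #(M/(ν_j Y + pM + ω_i M))` for EVERY `k`**, as soon as `i < j` and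
`#(M/(ν_j Y + pM + ω_i M)) < p^{p^i}` — for then `ν_j Y + pM + ω_i M = pM + ω_i M = pM` is the smallest of all the `ν_k Y + pM`.
[cite: Washington1997, §13.3 Lemma 13.18 and Prop. 13.22–13.23] [cite: Lang1990, Ch. 13 §4] -/
theorem card_quotient_le_of_card_quotient_coinvariant_lt (φ : Module.End ℤ M) {t : ℕ} (hφ : φ ^ p ^ t = 1)
    (Y : Submodule ℤ M) {i j : ℕ} (hij : i < j)
    (hlt : Nat.card (M ⧸ ((Y.map (∑ m ∈ range (p ^ j), φ ^ m) ⊔ (⊤ : Submodule ℤ M).map ((p : ℤ) • (1 : Module.End ℤ M))) ⊔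
        (⊤ : Submodule ℤ M).map (φ ^ p ^ i - 1))) < p ^ (p ^ i)) (k : ℕ) :
    Nat.card (M ⧸ (Y.map (∑ m ∈ range (p ^ k), φ ^ m) ⊔ (⊤ : Submodule ℤ M).map ((p : ℤ) • (1 : Module.End ℤ M)))) ≤
      Nat.card (M ⧸ ((Y.map (∑ m ∈ range (p ^ j), φ ^ m) ⊔ (⊤ : Submodule ℤ M).map ((p : ℤ) • (1 : Module.End ℤ M))) ⊔
        (⊤ : Submodule ℤ M).map (φ ^ p ^ i - 1))) := by
  set P : Submodule ℤ M := (⊤ : Submodule ℤ M).map ((p : ℤ) • (1 : Module.End ℤ M)) with hPdef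
  set W : Submodule ℤ M := (⊤ : Submodule ℤ M).map (φ ^ p ^ i - 1) with hWdef
  -- `ν_j Y + pM + ω_i M = pM + ω_i M`
  have hνle : Y.map (∑ m ∈ range (p ^ j), φ ^ m) ≤ P ⊔ W := map_geom_sum_le_sup (p := p) φ Y hij
  have heq1 : (Y.map (∑ m ∈ range (p ^ j), φ ^ m) ⊔ P) ⊔ W = P ⊔ W :=
    le_antisymm (sup_le (sup_le hνle le_sup_left) le_sup_right) (sup_le (le_sup_of_le_left le_sup_right) le_sup_right)
  rw [heq1] at hlt ⊢
  -- `ω_i M ⊆ pM`, so `pM + ω_i M = pM ≤ ν_k Y + pM`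
  have hWP : W ≤ P := map_pow_sub_one_le_of_card_quotient_lt (p := p) φ hφ i hlt
  have heq2 : P ⊔ W = P := sup_eq_left.mpr hWP
  rw [heq2]
  exact card_quotient_le_of_le le_sup_right

end Module

end Literature.NumberTheory.IwasawaTheory.FukudaCoinvariant

end
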